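import Mathlib
import HarnessLib
import Summits.QuantumAdvantage.QuantumAdvantage.Theses.WhiteBoxWalk
import Literature.Computability.QuantumComplexity.GluedTrees
import Literature.Computability.Cryptography.IndistinguishabilityObfuscatorSubexp

/-!
# Sketch (crux-ideate round 1, ideator 3) for crux `WbwObfuscatedGluedTrees`
(item stmt-QuantumAdvantage-2340, route WhiteBoxWalk).

First-lemma signatures for the idea cards
* `basin-ceiling-descent`  : `ClauseC`, `AvgUnreach`, `DescentTransfer`, `descend_step`
* `structureless-sibling-hop` : `CubicEndgame` (the unconditional endgame in the sibling world),
  `SiblingHopTransfer`.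
Nothing here is a route item; all decls live in a scratch namespace.
-/

open scoped BigOperators Classical
open Filter Asymptotics

namespace Summit.QuantumAdvantage.QuantumAdvantage.Theses.WhiteBoxWalk.CruxIdeas3

open Literature.Computability.Complexity Literature.Computability.Cryptography
open Literature.Computability.QuantumComplexity

/-! ## Clause (C) and its target-free generalisation -/

/-- Clause (C) of `WbwThesis` for a fixed `(gen, ans)`: every PPT, on `(1^n, gen s)` for uniform
`s ∈ {0,1}^n`, outputs `ans s` (as a prefix) with negligible probability. -/
def ClauseC (gen ans : List Bool → List Bool) : Prop :=
  ∀ A : RandAlg (List Bool) (List Bool), IsPPT A id →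
    SuperpolynomialDecay atTop (fun n : ℕ => (n : ℝ)) (fun n : ℕ =>
      uniformAvg n fun s => A.pr id (boolPair (Computability.unaryEncodeNat n) (gen s)) {y | ans s <+: y})

/-- Target-free generalisation: `good s` is ANY success event on outputs (e.g. "the output names a
right-tree vertex of depth `≤ j(s)`"). `AvgUnreach gen good` says no PPT hits `good s` except with
negligible probability on average over the seed. -/
def AvgUnreach (gen : List Bool → List Bool) (good : List Bool → Set (List Bool)) : Prop :=
  ∀ A : RandAlg (List Bool) (List Bool), IsPPT A id →
    SuperpolynomialDecay atTop (fun n : ℕ => (n : ℝ)) (fun n : ℕ =>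
      uniformAvg n fun s => A.pr id (boolPair (Computability.unaryEncodeNat n) (gen s)) (good s))

/-- (C) is the special case `good s = {y | ans s <+: y}`. -/
theorem clauseC_iff (gen ans : List Bool → List Bool) :
    ClauseC gen ans ↔ AvgUnreach gen (fun s => {y | ans s <+: y}) := Iff.rfl

/-- FIRST LEMMA of card `basin-ceiling-descent` (the lossless DESCENT TRANSFER).
If a deterministic polynomial-time map `D` turns every winning output for `(C)` into a `good`
output — `D (boolPair (gen s) y) ∈ good s` whenever `ans s <+: y` — then unreachability of `good`
implies clause (C).  Intended instance: `good s` = outputs whose `|name|`-prefix names a right-tree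
vertex of depth `j`, and `D` = "parse the prefix as a name `x`, evaluate the obfuscated neighbour
circuit contained in `gen s` at `x`, then walk `j - ?` steps always avoiding the previous vertex"
(`descend_step` below shows every such step goes one level down). Proof shape: compose `A` with
`D` (PPT is closed under deterministic poly-time post-processing) and compare events pointwise. -/
def DescentTransfer : Prop :=
  ∀ (gen ans : List Bool → List Bool) (good : List Bool → Set (List Bool)) (D : List Bool → List Bool),
    PolyTimeComputable id id D →
    (∀ s y, ans s <+: y → D (boolPair (gen s) y) ∈ good s) →
    AvgUnreach gen good → ClauseC gen ans

/-! ## The combinatorial heart of the descent: leaving a right-tree vertex by any edge other than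
the one to its parent goes one level DOWN (away from EXIT). -/

/-- In `G'_n(σ)`: if `v` is a non-leaf vertex of the EXIT tree, `u` its parent, and `w ≠ u` a
neighbour of `v`, then `w` is a child of `v`.  (So from `name(EXIT)` a classical walker reaches
depth `j` in exactly `j` circuit evaluations, for every `j ≤ n`: finding EXIT is no easier than
naming a depth-`j` right vertex — `(C) ⟸ AvgUnreach` at every level, losslessly.) -/
def DescendStep : Prop :=
  ∀ (n : ℕ) (σ : GluedTrees.CycleDatum n) (u v w : GluedTrees.Vertex n),
    v.1 = true → GluedTrees.IsChild v u → (v.2.1 : ℕ) < n →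
    (GluedTrees.graph n σ).Adj v w → w ≠ u → GluedTrees.IsChild w v

/-! ## Card `structureless-sibling-hop`: the sibling world and its unconditional endgame -/

/-- A cubic "structureless sibling": three permutations of `Fin M` (intended: fixed-point-free
involutions, i.e. three perfect matchings = a 3-edge-coloured cubic graph on `M` vertices). -/
abbrev CubicDatum (M : ℕ) : Type := Fin 3 → Equiv.Perm (Fin M)

/-- The neighbour-name set of the vertex named `a` in the sibling world (empty on invalid names). -/
noncomputable def cubicNbrNames {M N : ℕ} (τ : CubicDatum M) (ν : Fin M ↪ (Fin N → Bool))
    (a : Fin N → Bool) : Finset (Fin N → Bool) :=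
  (Finset.univ.filter fun x : Fin M => ν x = a).biUnion fun x =>
    (Finset.univ : Finset (Fin 3)).image fun c => ν (τ c x)

/-- The sibling oracle on bit strings, formatted exactly like `GluedTrees.strOracle` (sorted by
binary value, concatenated; `[]` on invalid queries). -/
noncomputable def cubicStrOracle {M N : ℕ} (τ : CubicDatum M) (ν : Fin M ↪ (Fin N → Bool)) : Oracle :=
  fun q => if h : q.length = N then
    ((((cubicNbrNames τ ν fun i => q.get (i.cast h.symm)).image GluedTrees.nameVal).sort (· ≤ ·)).map
      fun m => List.ofFn (GluedTrees.nameOfVal N m)).flatten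
  else []

/-- Outcomes of the sibling game: the three matchings, an injective naming by `N`-bit strings, and a
uniformly random designated target vertex (the image of "EXIT" under the hop). -/
abbrev CubicOutcome (M N : ℕ) : Type := CubicDatum M × (Fin M ↪ (Fin N → Bool)) × Fin M

/-- The algorithm `A` with advice `x`, started from the name of vertex `0`, names the target within
`t` rounds. -/
def NamesTarget {M N : ℕ} [NeZero M] {β : Type} (A : OracleAlg β) (x : List Bool) (t : ℕ)
    (ω : CubicOutcome M N) : Prop :=
  List.ofFn (ω.2.1 ω.2.2) ∈ A.queries (cubicStrOracle ω.1 ω.2.1) t (x ++ List.ofFn (ω.2.1 0))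

/-- FIRST LEMMA of card `structureless-sibling-hop` (the unconditional ENDGAME in the sibling
world): against uniformly random matchings, naming and target, a `t`-round transcript algorithm
started at vertex `0` names the target with probability at most `(3t + 2)/M` (it ever learns at
most `3t + 1` valid names besides guessing, and the target is uniform and independent of its
view).  Junk value when the outcome space is empty. -/
def CubicEndgame : Prop :=
  ∀ (M N : ℕ) [NeZero M] {β : Type} (A : OracleAlg β) (x : List Bool) (t : ℕ),
    ((Finset.univ.filter fun ω : CubicOutcome M N => NamesTarget A x t ω).card : ℝ) /
        Fintype.card (CubicOutcome M N) ≤ (3 * t + 2) / M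

/-- The SIBLING HOP as a transfer principle (abstract form): if the real instance distribution
and a sibling distribution are indistinguishable to PPT adversaries EQUIPPED WITH THE WIN-TEST
(so that the tested success probabilities differ negligibly), and success in the sibling world is
negligible, then clause (C) holds.  `pSib A n` = the probability that `A` outputs the designated
target string in the sibling world at parameter `n`. -/
def SiblingHopTransfer : Prop :=
  ∀ (gen ans : List Bool → List Bool) (pSib : RandAlg (List Bool) (List Bool) → ℕ → ℝ),
    (∀ A : RandAlg (List Bool) (List Bool), IsPPT A id →
      SuperpolynomialDecay atTop (fun n : ℕ => (n : ℝ)) (fun n : ℕ =>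
        |(uniformAvg n fun s => A.pr id (boolPair (Computability.unaryEncodeNat n) (gen s)) {y | ans s <+: y})
          - pSib A n|)) →
    (∀ A : RandAlg (List Bool) (List Bool), IsPPT A id →
      SuperpolynomialDecay atTop (fun n : ℕ => (n : ℝ)) (pSib A)) →
    ClauseC gen ans

/-- Sanity: the abstract hop transfer is just additivity of superpolynomial decay. -/
theorem siblingHopTransfer_holds : SiblingHopTransfer := by
  intro gen ans pSib hIndist hSib A hA
  have h1 := hIndist A hA
  have h2 := hSib A hA
  have h3 : SuperpolynomialDecay atTop (fun n : ℕ => (n : ℝ)) (fun n : ℕ =>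
      ((uniformAvg n fun s => A.pr id (boolPair (Computability.unaryEncodeNat n) (gen s)) {y | ans s <+: y})
        - pSib A n) + pSib A n) := by
    refine SuperpolynomialDecay.add ?_ h2
    -- |f| decays superpolynomially ⇒ f does
    intro k
    have hk := h1 k
    rw [tendsto_zero_iff_norm_tendsto_zero]
    refine hk.congr' (Eventually.of_forall fun n => ?_)
    simp only [Real.norm_eq_abs, abs_mul, abs_pow, Nat.abs_cast]
  refine h3.congr' (Eventually.of_forall fun n => ?_)
  ring


/-! ## Card `best-possible-transfer`: iO does one line -/

/-- The obfuscated generator built from a key-indexed circuit family `C`: the seed `s ∈ {0,1}^n`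
is split as `k := s.take (h n)` (keys) and `s.drop (h n)` (the obfuscator's coins); the instance is
`⟨code of iO(κ n, C k; coins), nm k⟩`. -/
def genObf (O : CircuitObfuscator) (κ h : ℕ → ℕ) (m : List Bool → ℕ)
    (C : (k : List Bool) → Circuit (Fin (m k))) (nm : List Bool → List Bool) (s : List Bool) : List Bool :=
  boolPair (encodeSizedCircuit ⟨m (s.take (h s.length)),
      O.obf (κ s.length) (C (s.take (h s.length))) (s.drop (h s.length))⟩) (nm (s.take (h s.length)))

/-- The CLEAR generator: same keys, the representation `C k` handed out un-obfuscated. -/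
def genClear (h : ℕ → ℕ) (m : List Bool → ℕ) (C : (k : List Bool) → Circuit (Fin (m k)))
    (nm : List Bool → List Bool) (s : List Bool) : List Bool :=
  boolPair (encodeSizedCircuit ⟨m (s.take (h s.length)), C (s.take (h s.length))⟩) (nm (s.take (h s.length)))

/-- FIRST LEMMA (a) of card `best-possible-transfer` — OBFUSCATION IS MONOTONE: if no PPT finds the
answer given the CLEAR representation `C k`, none finds it given `iO(C k)` with uniform independent
coins (the adversary can obfuscate by itself; `O.IsEfficient`). -/
def ObfuscationMonotone : Prop :=
  ∀ (O : CircuitObfuscator), O.IsEfficient →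
  ∀ (κ h : ℕ → ℕ) (m : List Bool → ℕ) (C : (k : List Bool) → Circuit (Fin (m k))) (nm ans : List Bool → List Bool),
    (∃ p : Polynomial ℕ, ∀ n, κ n ≤ p.eval n) → (∀ n, h n ≤ n) →
    (∀ s : List Bool, O.coins (κ s.length) (C (s.take (h s.length))) = s.length - h s.length) →
    ClauseC (genClear h m C nm) (fun s => ans (s.take (h s.length))) →
    ClauseC (genObf O κ h m C nm) (fun s => ans (s.take (h s.length)))

/-- FIRST LEMMA (b) of card `best-possible-transfer` — the BEST-POSSIBLE STEP: for two key-indexed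
families `C₀ k ≡ C₁ k` (same arity, same size, same function, both in the class at parameter `κ n`),
clause (C) for the obfuscations of `C₁` implies clause (C) for the obfuscations of `C₀`. Proof shape:
the `(2^{κ^ε}, 2^{-κ^ε})`-indistinguishability of `IsSubexpIO` is uniform over pairs and allows advice;
hardwire `(nm k, ans k)` for the worst `k` at each length as advice of the distinguisher
"run A, test the prefix", average over `k`, and use `κ n ≥ n^c`. -/
def BestPossibleStep : Prop :=
  ∀ (ε : ℝ) (O : CircuitObfuscator), 0 < ε → IsSubexpIO ε ppolyCircuits O →
  ∀ (κ h : ℕ → ℕ) (m : List Bool → ℕ) (C₀ C₁ : (k : List Bool) → Circuit (Fin (m k)))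
    (nm ans : List Bool → List Bool),
    (∃ c : ℝ, 0 < c ∧ ∀ᶠ n : ℕ in atTop, (n : ℝ) ^ c ≤ κ n) → (∃ p : Polynomial ℕ, ∀ n, κ n ≤ p.eval n) →
    (∀ n, h n ≤ n) →
    (∀ s : List Bool,
        (⟨m (s.take (h s.length)), C₀ (s.take (h s.length))⟩ : SizedCircuit) ∈ ppolyCircuits (κ s.length) ∧
        (⟨m (s.take (h s.length)), C₁ (s.take (h s.length))⟩ : SizedCircuit) ∈ ppolyCircuits (κ s.length) ∧
        (C₀ (s.take (h s.length))).size = (C₁ (s.take (h s.length))).size ∧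
        (∀ x, (C₀ (s.take (h s.length))).eval x = (C₁ (s.take (h s.length))).eval x) ∧
        O.coins (κ s.length) (C₀ (s.take (h s.length))) = s.length - h s.length ∧
        O.coins (κ s.length) (C₁ (s.take (h s.length))) = s.length - h s.length) →
    ClauseC (genObf O κ h m C₁ nm) (fun s => ans (s.take (h s.length))) →
    ClauseC (genObf O κ h m C₀ nm) (fun s => ans (s.take (h s.length)))

/-- The card's transfer, assembled: an EXIT-hiding CLEAR representation `C₁` of the same function and
size as the canonical neighbour circuit `C₀` gives clause (C) for the canonical obfuscated generator. -/
theorem clauseC_of_clear_representation (hM : ObfuscationMonotone) (hB : BestPossibleStep)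
    {ε : ℝ} {O : CircuitObfuscator} (hε : 0 < ε) (hO : IsSubexpIO ε ppolyCircuits O)
    (κ h : ℕ → ℕ) (m : List Bool → ℕ) (C₀ C₁ : (k : List Bool) → Circuit (Fin (m k)))
    (nm ans : List Bool → List Bool)
    (hκlo : ∃ c : ℝ, 0 < c ∧ ∀ᶠ n : ℕ in atTop, (n : ℝ) ^ c ≤ κ n) (hκhi : ∃ p : Polynomial ℕ, ∀ n, κ n ≤ p.eval n)
    (hh : ∀ n, h n ≤ n)
    (hpair : ∀ s : List Bool,
        (⟨m (s.take (h s.length)), C₀ (s.take (h s.length))⟩ : SizedCircuit) ∈ ppolyCircuits (κ s.length) ∧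
        (⟨m (s.take (h s.length)), C₁ (s.take (h s.length))⟩ : SizedCircuit) ∈ ppolyCircuits (κ s.length) ∧
        (C₀ (s.take (h s.length))).size = (C₁ (s.take (h s.length))).size ∧
        (∀ x, (C₀ (s.take (h s.length))).eval x = (C₁ (s.take (h s.length))).eval x) ∧
        O.coins (κ s.length) (C₀ (s.take (h s.length))) = s.length - h s.length ∧
        O.coins (κ s.length) (C₁ (s.take (h s.length))) = s.length - h s.length)
    (hclear : ClauseC (genClear h m C₁ nm) (fun s => ans (s.take (h s.length)))) :
    ClauseC (genObf O κ h m C₀ nm) (fun s => ans (s.take (h s.length))) :=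
  hB ε O hε hO κ h m C₀ C₁ nm ans hκlo hκhi hh hpair
    (hM O hO.isEfficient κ h m C₁ nm ans hκhi hh (fun s => (hpair s).2.2.2.2.2) hclear)

end Summit.QuantumAdvantage.QuantumAdvantage.Theses.WhiteBoxWalk.CruxIdeas3
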